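import Summits.ResolutionOfSingularities.ResolutionOfSingularities.Theorems.WeightedInvariantLocalWeightedDropTrackCStep
import Summits.ResolutionOfSingularities.ResolutionOfSingularities.Theorems.WeightedInvariantLocalWeightedDropTrackCEnd
import Summits.ResolutionOfSingularities.ResolutionOfSingularities.Theorems.WeightedInvariantLocalWeightedDropTrackCBase
import Summits.ResolutionOfSingularities.ResolutionOfSingularities.Theorems.WeightedInvariantLocalWeightedDropTrackCForward

/-!
# TRACK C: every singular surface germ is won, conditionally on the Cossart–Jannsen–Saito sequence (F-32b)

[OURS · L1 W4.3 · chain w43 (CHAIN.md v3), stub worker 4] The N = 3 MILESTONE of the engine crux `LocalWeightedDrop`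
(stmt-ResolutionOfSingularities-8899), CLOSED MODULO the audited printed fact F-32b
`Literature.AlgebraicGeometry.Resolution.CossartJannsenSaito2020EmbeddedSequence` (CJS, LNM 2270, Thm. 1.4 «more precisely» +
Thm. 6.9 (a)): the plan-1 target `L/res-L1-w43-plan-1/TrackC_SurfaceGermsWon_of_CJSSequence.lean` (evidence #58), verbatim.
NOT a statement of any manuscript; the game (`CobordantGame.Won`) is the programme's own.

PROOF ARCHITECTURE (skeleton `L/res-L1-w43-stub-4/TrackC_Skeleton.lean`, evidence #46; all pieces landed as helpers):
track ONLY the total transform `T_z = σ♯ f ∈ 𝒪_{Z',z}` at FRAMED points (`WonAt f σ`: every singular divisor of `T_z` read in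
any Cohen frame `𝒪̂_{Z',z} ≃ k⟦X₀,X₁,X₂⟧` is won; `…TrackCDefs`).
* BASE `won_of_wonAt_id` (`…TrackCBase`): `WonAt f (𝟙 Z₀)` wins `f` (tautological frame at the closed point).
* STEP `wonAt_of_wonAt_blowup` (`…TrackCStep`): `WonAt f (τ ≫ σ) → WonAt f σ` for each blow-up of the sequence — the Prover
  plays the blow-up of the centre written in a frame adapted to it (Matsumura 14.2; change of frame `…TrackCFrames`), a singular
  successor is won with its slice (tame weight `1`, `TameSuccessor.won_successor_of_won_slice`), and the slice divides the total
  transform in the Cohen frame at the Refuter's point of the blow-up, where the completed blow-up IS the restricted chart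
  substitution (`…TrackCChartPoint/ChartHom/ChartFrame`: `exists_frame_square`); off the centre frames are transported
  (`…TrackCOffCentre`). Integrality / local Noetherianity / non-zero centres along the sequence: `…TrackCForward`.
* INDUCTION `wonAt_transformer` along `IsBPermissibleSequence`.
* END `wonAt_end` (`…TrackCEnd`): at the end `π⁻¹(V f) = X₁ ∪ B₁` with `X₁` transversal to the snc divisor `B₁`, so
  `√(π♯f) = I(X₁)_z ∩ I(B₁)_z` and `π♯ f` is a unit times a monomial in a regular system of parameters (UFD, Matsumura 20.3):
  won by one weight-one move per variable (`…TrackCMonomialDivisor`).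
* INPUT `exists_sequence` (`…TrackCBase`): CJS applied to `V(f) ⊂ Spec k⟦x₀,x₁,x₂⟧` (Noetherian, regular, excellent; `dim V(f) ≤ 2`).
-/

noncomputable section

open CategoryTheory CategoryTheory.Limits AlgebraicGeometry TopologicalSpace IsLocalRing
open Literature.AlgebraicGeometry.Resolution
open Scheme.IdealSheafData

set_option linter.dupNamespace false -- mandated namespace of this single-conjunct summit

namespace Summit.ResolutionOfSingularities.ResolutionOfSingularities.Theorems.TrackC

variable {k : Type} [Field k]

/-- **INDUCTION along the sequence.** `WonAt f σ → WonAt f (𝟙 Z₀)` for every `𝓑`-permissible sequence `σ : Z' ⟶ Z₀` over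
`Z₀ = Spec k⟦x₀,x₁,x₂⟧`. [OURS · folklore] -/
theorem wonAt_transformer (p : ℕ) (hp : p.Prime) [CharP k p] (f : MvPowerSeries (Fin 3) k)
    {X B : Set (Spec (.of (MvPowerSeries (Fin 3) k)))} {Z' : Scheme.{0}}
    {σ : Z' ⟶ Spec (.of (MvPowerSeries (Fin 3) k))} {X' B' : Set Z'}
    (hseq : IsBPermissibleSequence X B σ X' B') :
    WonAt f σ → WonAt f (𝟙 (Spec (.of (MvPowerSeries (Fin 3) k)))) := by
  haveI : IsDomain (MvPowerSeries (Fin 3) k) := NoZeroDivisors.to_isDomain _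
  haveI : IsNoetherianRing (MvPowerSeries (Fin 3) k) := isNoetherianRing_mvPowerSeries (Fin 3) (R := k)
  induction hseq with
  | refl => exact id
  | @blowup Z' Z'' σ X' B' h C τ hτ hreg hsub hsing hperm hnc ih =>
    intro hW
    obtain ⟨hint, hnoeth, -⟩ := forward h
    haveI := hint
    haveI := hnoeth
    exact ih (wonAt_of_wonAt_blowup p hp f σ C τ hτ hreg (centre_ne_bot C hsub hsing) hW)

-- REMOVE-WHEN the superseded fact `CossartJannsenSaito2020EmbeddedSequence` (refuted as typed, kernel certificate
-- `not_cossartJannsenSaito2020EmbeddedSequence`) is deleted from the tree: this consumer is kept for the record only; the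
-- live results are the `…B` forms (`TrackC.exists_sequence_zeroLocusB`, `TrackC.surfaceGermsWon_of_CJSSequenceB`).
set_option linter.deprecated false in
/-- The CJS input with the strict transform's origin made explicit: a `𝓑`-permissible sequence of
`(V(f), Spec k⟦x⟧, ∅)` (so the strict transform is closed, `isClosed_of_seq`). [OURS · folklore] -/
theorem exists_sequence_zeroLocus (hCJS : CossartJannsenSaito2020EmbeddedSequence.{0}) (f : MvPowerSeries (Fin 3) k)
    (hf : f ≠ 0) :
    ∃ (Z₁ : Scheme.{0}) (π : Z₁ ⟶ Spec (.of (MvPowerSeries (Fin 3) k))) (X₁ B₁ : Set Z₁),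
      IsBPermissibleSequence ((Spec (.of (MvPowerSeries (Fin 3) k))).zeroLocus (U := ⊤)
        {(Scheme.ΓSpecIso (.of (MvPowerSeries (Fin 3) k))).inv.hom f} : Set _) ∅ π X₁ B₁ ∧
      IsStrictNormalCrossingsDivisor Z₁ B₁ ∧
      π ⁻¹' ((Spec (.of (MvPowerSeries (Fin 3) k))).zeroLocus (U := ⊤)
        {(Scheme.ΓSpecIso (.of (MvPowerSeries (Fin 3) k))).inv.hom f} : Set _) = X₁ ∪ B₁ ∧
      IsTransversalWith Z₁ X₁ B₁ := by
  haveI : IsNoetherianRing (MvPowerSeries (Fin 3) k) := isNoetherianRing_mvPowerSeries (Fin 3) (R := k)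
  haveI : IsRegularLocalRing (MvPowerSeries (Fin 3) k) := isRegularLocalRing_mvPowerSeries k (Fin 3)
  haveI : IsRegularRing (MvPowerSeries (Fin 3) k) := isRegularRing_of_isRegularLocalRing _
  have hreg : Scheme.IsRegular (Spec (.of (MvPowerSeries (Fin 3) k))) := Scheme.isRegular_Spec (.of _)
  haveI : IsAdicComplete (maximalIdeal (MvPowerSeries (Fin 3) k)) (MvPowerSeries (Fin 3) k) := by
    rw [maximalIdeal_mvPowerSeries_eq_span]
    infer_instance
  have hexc : Scheme.IsExcellent (Spec (.of (MvPowerSeries (Fin 3) k))) :=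
    Scheme.isExcellent_Spec_of_isExcellentRing _ (isExcellentRing_of_isAdicComplete _)
  obtain ⟨Z₁, π, X₁, B₁, hseq, -, -, -, -, -, hB₁, htot, htr⟩ :=
    CossartJannsenSaito2020EmbeddedSequence.of_isClosed hCJS (Spec (.of (MvPowerSeries (Fin 3) k)))
      hreg hexc _ (isClosed_zeroLocus (k := k) f) (topologicalKrullDim_zeroLocus_le k f hf)
  exact ⟨Z₁, π, X₁, B₁, hseq, hB₁, htot, htr⟩

-- REMOVE-WHEN the superseded fact `CossartJannsenSaito2020EmbeddedSequence` (refuted as typed, kernel certificate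
-- `not_cossartJannsenSaito2020EmbeddedSequence`) is deleted from the tree: this consumer is kept for the record only; the
-- live results are the `…B` forms (`TrackC.exists_sequence_zeroLocusB`, `TrackC.surfaceGermsWon_of_CJSSequenceB`).
set_option linter.deprecated false in
/-- **TRACK C (N = 3 milestone of the engine crux `LocalWeightedDrop`, CLOSED MODULO F-32b).** The `𝓑`-permissible embedded
resolution SEQUENCE for reduced excellent surfaces (`CossartJannsenSaito2020EmbeddedSequence`, universe `0`) implies that every
singular surface germ `f ∈ k⟦x₀,x₁,x₂⟧` over an algebraically closed field of prime characteristic is won in the local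
weighted resolution game. (`IsAlgClosed` is not used by the proof; it is kept to match the typed target verbatim.)
[OURS · L1 W4.3] -/
theorem surfaceGermsWon_of_CJSSequence (hCJS : CossartJannsenSaito2020EmbeddedSequence.{0}) :
    ∀ (p : ℕ), p.Prime → ∀ (k : Type) [Field k] [CharP k p] [IsAlgClosed k] (f : MvPowerSeries (Fin 3) k),
      CobordantGame.IsSingular k f → CobordantGame.Won k 3 f := by
  intro p hp k _ _ _ f hf
  obtain ⟨Z₁, π, X₁, B₁, hseq, hB₁, htot, htr⟩ := exists_sequence_zeroLocus (k := k) hCJS f hf.1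
  have hX₁c : IsClosed X₁ := isClosed_of_seq hseq (isClosed_zeroLocus (k := k) f)
  exact won_of_wonAt_id (k := k) f
    (wonAt_transformer p hp f hseq (wonAt_end f π X₁ B₁ hX₁c hB₁ htot htr (totalGerm_ne_zero hseq hf.1))) hf

end Summit.ResolutionOfSingularities.ResolutionOfSingularities.Theorems.TrackC

end
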